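import Summits.QuantumFields.BalabanUV.Beta.SymRootedMixedChartReflection
import Summits.QuantumFields.BalabanUV.Beta.RootedMixedJetLinear

/-!
# `BalabanUV.Beta.SymRootedMixedJetLinear` — LINEARITY AND `Tau`-CENTRALITY OF THE (0.4)-SYMMETRISED ROOTED MIXED JET IN THE
# BACKGROUND LETTER on the mixed left chart with general background (`GmL`∕`GmbL`∕`symPhiMLAt`∕`symMjetLAt`), hence of `symMjetAt` in `B`
# (β sub-cell, row D1, TABLES-SYM-LEAN S2c, INTERFACE-LEVEL twin of an3-g33's `RootedMixedJetLinear`; an1 gen 43, option (C) of S2C-SCOPE-v1)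

HONEST FRAMING (cell charter, verbatim): «discharging BetaPertH makes Bałaban's UV stability UNCONDITIONAL — a real
constructive-QFT result; it is NOT the continuum limit and NOT the Clay problem.»  HONEST DEPENDENCY (verbatim): «continuum YM on
T⁴ ⇐ BetaPertH ∧ nine spine estimates (0/9 proved); BetaPertH ⇐ (D1) ∧ (D4) ∧ CAP+tail; G-an2-4 gates asym, D1 and NE2/3/4.»
ABSOLUTE RULE (R-g25-7 ∕ R-D1-g30-1 (A)): the (0.4)-symmetrised averaging is the exp of the MEAN OF LOGS over the pair family; every
object below is the comb module's algebra read on an1's `symPhiGAt` (S2b part 1) instead of `PhiGAt` — statement for statement,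
`MσGAt ↦ symMσGAt`, `MσLAt ↦ symMσLAt`, `MjetLAt ↦ symMjetLAt`, `MjetAt ↦ symMjetAt`; the only averaging-specific inputs are
`map_symPhiGAt` and `symPhiGAt_one`.  The two-letter charts `GmL2`∕`GmbL2` and `upF_add`∕`upF_neg` are FAMILY-INDEPENDENT and imported
BY NAME from `RootedMixedJetLinear`.
DERIVED cell leaf: [folklore] ring algebra.  No statement of Bałaban's papers is typed here, no `[cite:]` tag, no `Prop` is minted, no
binder of the β-function wall (`hW`/`hR`/`D1Tel`/`D1Rep`, (D1), `BetaPertH`) is instantiated or discharged; nothing about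
`symMixFFAt`∕`symVh₂SAt`∕(T2-B)∕(T2-M₂).  NOT summit progress.

## What this module proves (sym twin, same section numbering as the comb module)
* §0 `symMσGAt ρ Z Z̄′ b Z₀ Z̄₀ c := (logT (symΦ^L(Z, Z̄′, b) · invT symΦ^L(Z₀, Z̄₀, c))).snd`; `symMσLAt` is its diagonal (`rfl`);
* §1 CENTRALITY `symMσGAt_mul_central`, `symMσLAt_mul_central`, `symMjetLAt_τ₁_mul`∕`_τ₂_mul`∕`_τ12_mul`, `symMσLAt_smul`;
* §2 JOINT ADDITIVITY `symMσGAt_add₂`, `symMσGAt_eq_symMσLAt_add`, `symMσLAt_add` (`_zero`, `_neg`, `_sub`, `_sum`), the same for `symMjetLAt`;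
* §3 `symMjetAt_add_B`, `_neg_B`, `_sub_B`, `_sum_B`.
-/

namespace Summit.QuantumFields.BalabanUV.Beta.SymRootedMixedJetLinear

open Literature.MathematicalPhysics.QuantumFieldTheory.Balaban1983to89
open Literature.MathematicalPhysics.QuantumFieldTheory.Balaban1983to89.Beta
open AffineAveraging (Form1)
open AveragingThirdJet (Tau Rho dmk fst_dmk snd_dmk dfst_mul dsnd_mul mapDual fst_mapDual snd_mapDual scaleDual fst_scaleDual
  snd_scaleDual mergeDual fst_mergeDual snd_mergeDual upF upF_apply logT invT map_logT map_invT)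
open AveragingThirdJet.Tau (τ₁ τ₂ τ12 ι c00 c10 c01 c11 c11_add c11_neg c11_smul c11_τ₁_mul c11_τ₂_mul c11_τ12_mul τ₁_comm τ₂_comm
  τ12_comm ext4)
open AveragingMixedJetTables (Zf Zb)
open Summit.QuantumFields.BalabanUV.Beta.RootedMixedChartReflection (GmL GmbL fst_GmL snd_GmL fst_GmbL snd_GmbL)
open Summit.QuantumFields.BalabanUV.Beta.RootedMixedJetLinear (GmL2 GmbL2 fst_GmL2 snd_GmL2 fst_GmbL2 snd_GmbL2 upF_add upF_neg)
open Summit.QuantumFields.BalabanUV.Beta.SymAveragingMixedJetTables (symPhiGAt map_symPhiGAt symPhiGAt_one symMjetAt symMjetAt_B_zero)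
open Summit.QuantumFields.BalabanUV.Beta.SymRootedMixedChartReflection (symPhiMLAt symMσLAt symMjetLAt symMjetAt_eq_symMjetLAt)

variable (𝕜 : Type*) [Field 𝕜] {d : ℕ} {𝔸 : Type*} [Ring 𝔸] [Algebra 𝕜 𝔸]

/-! ## §0 The `Tau`-valued σ-jets -/

/-- [our object] THE `Tau`-VALUED TWO-BACKGROUND σ-JET of the mixed left chart: the σ-coefficient of
`logT (Φ^L(Z, Z̄′, b) · invT Φ^L(Z₀, Z̄₀, c))` — numerator background `b`, reference pair `(Z₀, Z̄₀)` at reference background `c`. -/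
noncomputable def symMσGAt (ρ : Fin d → ℤ) (Z Zb' b Z₀ Zb₀ c : Form1 d (Tau 𝔸)) (L : ℕ) (μ : Fin d) (y : Fin d → ℤ) : Tau 𝔸 :=
  (logT 𝕜 (symPhiMLAt 𝕜 ρ Z Zb' b L μ y * invT (symPhiMLAt 𝕜 ρ Z₀ Zb₀ c L μ y))).snd

variable {𝕜}

/-- [folklore] BRIDGE: leaf-05's common-background σ-jet `symMσLAt` is the diagonal `c = b` of `symMσGAt`. -/
theorem symMσLAt_eq_symMσGAt (ρ : Fin d → ℤ) (Z Zb' Z₀ Zb₀ b : Form1 d (Tau 𝔸)) (L : ℕ) (μ : Fin d) (y : Fin d → ℤ) :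
    symMσLAt 𝕜 ρ Z Zb' Z₀ Zb₀ b L μ y = symMσGAt 𝕜 ρ Z Zb' b Z₀ Zb₀ b L μ y := rfl

/-- [folklore] BRIDGE: `symMjetLAt = c11 ∘ symMσLAt` (leaf-05's `symMjetLAt_eq_c11`, restated for the local rewriting chains). -/
theorem symMjetLAt_eq_c11_symMσLAt (ρ : Fin d → ℤ) (Z Zb' Z₀ Zb₀ b : Form1 d (Tau 𝔸)) (L : ℕ) (μ : Fin d) (y : Fin d → ℤ) :
    symMjetLAt 𝕜 ρ Z Zb' Z₀ Zb₀ b L μ y = c11 (symMσLAt 𝕜 ρ Z Zb' Z₀ Zb₀ b L μ y) := rfl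

/-- [folklore] The un-normalised σ-jet (reference background `0`) is the σ-component of `logT (Φ^L(Z, Z̄′, b) · invT Φ^L(Z₀, Z̄₀, 0))`;
at the trivial reference pair `Z₀ = Z̄₀ = 1` it is the σ-component of `logT Φ^L(Z, Z̄′, b)` (`symMσGAt_one_one_zero`). -/
theorem symMσGAt_one_one_zero (ρ : Fin d → ℤ) (Z Zb' b : Form1 d (Tau 𝔸)) (L : ℕ) (μ : Fin d) (y : Fin d → ℤ) :
    symMσGAt 𝕜 ρ Z Zb' b (fun _ _ => 1) (fun _ _ => 1) 0 L μ y = (logT 𝕜 (symPhiMLAt 𝕜 ρ Z Zb' b L μ y)).snd := by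
  have h1 : GmL (fun _ _ => (1 : Tau 𝔸)) (0 : Form1 d (Tau 𝔸)) = fun _ _ => 1 := by
    funext κ x; exact TrivSqZeroExt.ext (by simp) (by simp)
  have h1b : GmbL (fun _ _ => (1 : Tau 𝔸)) (0 : Form1 d (Tau 𝔸)) = fun _ _ => 1 := by
    funext κ x; exact TrivSqZeroExt.ext (by simp) (by simp)
  rw [symMσGAt, symPhiMLAt, symPhiMLAt, h1, h1b, symPhiGAt_one, AveragingThirdJet.invT_one, mul_one]

/-! ## §1 Centrality -/

/-- [folklore] HOMOGENEITY of the two-background σ-jet under CENTRAL elements of `Tau 𝔸` multiplying BOTH background letters. -/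
theorem symMσGAt_mul_central (s : Tau 𝔸) (hs : ∀ t, s * t = t * s) (ρ : Fin d → ℤ) (Z Zb' b Z₀ Zb₀ c : Form1 d (Tau 𝔸)) (L : ℕ)
    (μ : Fin d) (y : Fin d → ℤ) :
    symMσGAt 𝕜 ρ Z Zb' (fun κ x => s * b κ x) Z₀ Zb₀ (fun κ x => s * c κ x) L μ y = s * symMσGAt 𝕜 ρ Z Zb' b Z₀ Zb₀ c L μ y := by
  have hG : ∀ (Z b : Form1 d (Tau 𝔸)) κ x, scaleDual (𝕜 := 𝕜) s hs (GmL Z b κ x) = GmL Z (fun κ x => s * b κ x) κ x :=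
    fun Z b κ x => TrivSqZeroExt.ext (by simp) (by rw [snd_scaleDual, snd_GmL, snd_GmL, ← mul_assoc, hs, mul_assoc])
  have hGb : ∀ (Zb' b : Form1 d (Tau 𝔸)) κ x, scaleDual (𝕜 := 𝕜) s hs (GmbL Zb' b κ x) = GmbL Zb' (fun κ x => s * b κ x) κ x :=
    fun Zb' b κ x => TrivSqZeroExt.ext (by simp) (by rw [snd_scaleDual, snd_GmbL, snd_GmbL, mul_neg, mul_assoc])
  unfold symMσGAt symPhiMLAt
  have key := congrArg TrivSqZeroExt.snd (map_logT (scaleDual (𝕜 := 𝕜) s hs)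
    (symPhiGAt 𝕜 ρ (GmL Z b) (GmbL Zb' b) L μ y * invT (symPhiGAt 𝕜 ρ (GmL Z₀ c) (GmbL Zb₀ c) L μ y)))
  simp only [map_mul, map_invT, map_symPhiGAt, hG, hGb, snd_scaleDual] at key
  exact key.symm

/-- [folklore] HOMOGENEITY of the common-background σ-jet under CENTRAL elements of `Tau 𝔸`. -/
theorem symMσLAt_mul_central (s : Tau 𝔸) (hs : ∀ t, s * t = t * s) (ρ : Fin d → ℤ) (Z Zb' Z₀ Zb₀ b : Form1 d (Tau 𝔸)) (L : ℕ)
    (μ : Fin d) (y : Fin d → ℤ) :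
    symMσLAt 𝕜 ρ Z Zb' Z₀ Zb₀ (fun κ x => s * b κ x) L μ y = s * symMσLAt 𝕜 ρ Z Zb' Z₀ Zb₀ b L μ y := by
  rw [symMσLAt_eq_symMσGAt, symMσLAt_eq_symMσGAt]; exact symMσGAt_mul_central s hs ρ Z Zb' b Z₀ Zb₀ b L μ y

/-- [folklore] … for the un-normalised jet (reference background `0`). -/
theorem symMσGAt_mul_central_zero (s : Tau 𝔸) (hs : ∀ t, s * t = t * s) (ρ : Fin d → ℤ) (Z Zb' b Z₀ Zb₀ : Form1 d (Tau 𝔸)) (L : ℕ)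
    (μ : Fin d) (y : Fin d → ℤ) :
    symMσGAt 𝕜 ρ Z Zb' (fun κ x => s * b κ x) Z₀ Zb₀ 0 L μ y = s * symMσGAt 𝕜 ρ Z Zb' b Z₀ Zb₀ 0 L μ y := by
  have h := symMσGAt_mul_central (𝕜 := 𝕜) s hs ρ Z Zb' b Z₀ Zb₀ 0 L μ y
  simp only [Pi.zero_apply, mul_zero] at h
  exact h

/-- [folklore] … for `τ₁`, at the level of the `τ₁τ₂`-component: `Mjet(τ₁·b) = c01 Mσ(b)`. -/
theorem symMjetLAt_τ₁_mul (ρ : Fin d → ℤ) (Z Zb' Z₀ Zb₀ b : Form1 d (Tau 𝔸)) (L : ℕ) (μ : Fin d) (y : Fin d → ℤ) :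
    symMjetLAt 𝕜 ρ Z Zb' Z₀ Zb₀ (fun κ x => τ₁ * b κ x) L μ y = c01 (symMσLAt 𝕜 ρ Z Zb' Z₀ Zb₀ b L μ y) := by
  rw [symMjetLAt_eq_c11_symMσLAt, symMσLAt_mul_central τ₁ τ₁_comm, c11_τ₁_mul]

/-- [folklore] … for `τ₂`: `Mjet(τ₂·b) = c10 Mσ(b)`. -/
theorem symMjetLAt_τ₂_mul (ρ : Fin d → ℤ) (Z Zb' Z₀ Zb₀ b : Form1 d (Tau 𝔸)) (L : ℕ) (μ : Fin d) (y : Fin d → ℤ) :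
    symMjetLAt 𝕜 ρ Z Zb' Z₀ Zb₀ (fun κ x => τ₂ * b κ x) L μ y = c10 (symMσLAt 𝕜 ρ Z Zb' Z₀ Zb₀ b L μ y) := by
  rw [symMjetLAt_eq_c11_symMσLAt, symMσLAt_mul_central τ₂ τ₂_comm, c11_τ₂_mul]

/-- [folklore] … for `τ₁τ₂`: `Mjet(τ₁τ₂·b) = c00 Mσ(b)`. -/
theorem symMjetLAt_τ12_mul (ρ : Fin d → ℤ) (Z Zb' Z₀ Zb₀ b : Form1 d (Tau 𝔸)) (L : ℕ) (μ : Fin d) (y : Fin d → ℤ) :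
    symMjetLAt 𝕜 ρ Z Zb' Z₀ Zb₀ (fun κ x => τ12 * b κ x) L μ y = c00 (symMσLAt 𝕜 ρ Z Zb' Z₀ Zb₀ b L μ y) := by
  rw [symMjetLAt_eq_c11_symMσLAt, symMσLAt_mul_central τ12 τ12_comm, c11_τ12_mul]

/-- [folklore] `𝕜`-HOMOGENEITY of the σ-jet in the background letter. -/
theorem symMσLAt_smul (r : 𝕜) (ρ : Fin d → ℤ) (Z Zb' Z₀ Zb₀ b : Form1 d (Tau 𝔸)) (L : ℕ) (μ : Fin d) (y : Fin d → ℤ) :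
    symMσLAt 𝕜 ρ Z Zb' Z₀ Zb₀ (r • b) L μ y = r • symMσLAt 𝕜 ρ Z Zb' Z₀ Zb₀ b L μ y := by
  have h := symMσLAt_mul_central (𝕜 := 𝕜) (algebraMap 𝕜 (Tau 𝔸) r) (fun t => Algebra.commutes r t) ρ Z Zb' Z₀ Zb₀ b L μ y
  simp only [← Algebra.smul_def] at h
  exact h

/-! ## §2 Additivity -/


set_option synthInstance.maxHeartbeats 200000 in
set_option maxHeartbeats 1600000 in
/-- [folklore] **JOINT ADDITIVITY OF THE TWO-BACKGROUND σ-JET IN THE PAIR (numerator background, reference background)** (node 12's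
three-map proof: kill `ρ′`, kill `ρ`, merge `ρ′ = ρ`, on doubled letters in numerator AND reference). -/
theorem symMσGAt_add₂ (ρ : Fin d → ℤ) (Z Zb' b₁ b₂ Z₀ Zb₀ c₁ c₂ : Form1 d (Tau 𝔸)) (L : ℕ) (μ : Fin d) (y : Fin d → ℤ) :
    symMσGAt 𝕜 ρ Z Zb' (b₁ + b₂) Z₀ Zb₀ (c₁ + c₂) L μ y = symMσGAt 𝕜 ρ Z Zb' b₁ Z₀ Zb₀ c₁ L μ y + symMσGAt 𝕜 ρ Z Zb' b₂ Z₀ Zb₀ c₂ L μ y := by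
  have h2 : ∀ (Z b₁ b₂ : Form1 d (Tau 𝔸)) κ x,
      mapDual (TrivSqZeroExt.fstHom 𝕜 (Tau 𝔸) (Tau 𝔸)) (GmL2 Z b₁ b₂ κ x) = GmL Z b₂ κ x :=
    fun Z b₁ b₂ κ x => TrivSqZeroExt.ext (by simp) (by simp)
  have h2b : ∀ (Zb' b₁ b₂ : Form1 d (Tau 𝔸)) κ x,
      mapDual (TrivSqZeroExt.fstHom 𝕜 (Tau 𝔸) (Tau 𝔸)) (GmbL2 Zb' b₁ b₂ κ x) = GmbL Zb' b₂ κ x :=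
    fun Zb' b₁ b₂ κ x => TrivSqZeroExt.ext (by simp) (by simp)
  have h3 : ∀ (Z b₁ b₂ : Form1 d (Tau 𝔸)) κ x, mergeDual (𝕜 := 𝕜) (GmL2 Z b₁ b₂ κ x) = GmL Z (b₁ + b₂) κ x :=
    fun Z b₁ b₂ κ x => TrivSqZeroExt.ext (by simp) (by simp [mul_add])
  have h3b : ∀ (Zb' b₁ b₂ : Form1 d (Tau 𝔸)) κ x, mergeDual (𝕜 := 𝕜) (GmbL2 Zb' b₁ b₂ κ x) = GmbL Zb' (b₁ + b₂) κ x :=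
    fun Zb' b₁ b₂ κ x => TrivSqZeroExt.ext (by simp) (by
      rw [snd_mergeDual, fst_GmbL2, snd_GmbL2, snd_GmbL, fst_dmk, snd_GmbL, Pi.add_apply, Pi.add_apply, add_mul, neg_add])
  unfold symMσGAt symPhiMLAt
  have k1 := congrArg TrivSqZeroExt.snd (map_logT (TrivSqZeroExt.fstHom 𝕜 (Rho 𝔸) (Rho 𝔸))
    (symPhiGAt 𝕜 ρ (GmL2 Z b₁ b₂) (GmbL2 Zb' b₁ b₂) L μ y * invT (symPhiGAt 𝕜 ρ (GmL2 Z₀ c₁ c₂) (GmbL2 Zb₀ c₁ c₂) L μ y)))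
  simp only [map_mul, map_invT, map_symPhiGAt, TrivSqZeroExt.fstHom_apply, fst_GmL2, fst_GmbL2] at k1
  have k2 := congrArg TrivSqZeroExt.snd (map_logT (mapDual (TrivSqZeroExt.fstHom 𝕜 (Tau 𝔸) (Tau 𝔸)))
    (symPhiGAt 𝕜 ρ (GmL2 Z b₁ b₂) (GmbL2 Zb' b₁ b₂) L μ y * invT (symPhiGAt 𝕜 ρ (GmL2 Z₀ c₁ c₂) (GmbL2 Zb₀ c₁ c₂) L μ y)))
  simp only [map_mul, map_invT, map_symPhiGAt, h2, h2b, snd_mapDual, TrivSqZeroExt.fstHom_apply] at k2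
  have k3 := congrArg TrivSqZeroExt.snd (map_logT (mergeDual (𝕜 := 𝕜))
    (symPhiGAt 𝕜 ρ (GmL2 Z b₁ b₂) (GmbL2 Zb' b₁ b₂) L μ y * invT (symPhiGAt 𝕜 ρ (GmL2 Z₀ c₁ c₂) (GmbL2 Zb₀ c₁ c₂) L μ y)))
  simp only [map_mul, map_invT, map_symPhiGAt, h3, h3b, snd_mergeDual] at k3
  exact k3.symm.trans (congrArg₂ HAdd.hAdd k1 k2)

/-- [folklore] **THE REFERENCE SHIFT**: a background correction `D` in the NUMERATOR only adds its un-normalised σ-jet —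
`symMσGAt … (c + D) … c = symMσLAt … c + symMσGAt … D … 0`. -/
theorem symMσGAt_eq_symMσLAt_add (ρ : Fin d → ℤ) (Z Zb' Z₀ Zb₀ c D : Form1 d (Tau 𝔸)) (L : ℕ) (μ : Fin d) (y : Fin d → ℤ) :
    symMσGAt 𝕜 ρ Z Zb' (c + D) Z₀ Zb₀ c L μ y = symMσLAt 𝕜 ρ Z Zb' Z₀ Zb₀ c L μ y + symMσGAt 𝕜 ρ Z Zb' D Z₀ Zb₀ 0 L μ y := by
  have h := symMσGAt_add₂ (𝕜 := 𝕜) ρ Z Zb' c D Z₀ Zb₀ c 0 L μ y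
  rw [add_zero] at h
  rw [symMσLAt_eq_symMσGAt]; exact h

/-- [folklore] ADDITIVITY of the common-background σ-jet in the background letter. -/
theorem symMσLAt_add (ρ : Fin d → ℤ) (Z Zb' Z₀ Zb₀ b₁ b₂ : Form1 d (Tau 𝔸)) (L : ℕ) (μ : Fin d) (y : Fin d → ℤ) :
    symMσLAt 𝕜 ρ Z Zb' Z₀ Zb₀ (b₁ + b₂) L μ y = symMσLAt 𝕜 ρ Z Zb' Z₀ Zb₀ b₁ L μ y + symMσLAt 𝕜 ρ Z Zb' Z₀ Zb₀ b₂ L μ y := by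
  rw [symMσLAt_eq_symMσGAt, symMσLAt_eq_symMσGAt, symMσLAt_eq_symMσGAt]; exact symMσGAt_add₂ ρ Z Zb' b₁ b₂ Z₀ Zb₀ b₁ b₂ L μ y

/-- [folklore] ADDITIVITY of the un-normalised σ-jet in the background letter. -/
theorem symMσGAt_add_zero (ρ : Fin d → ℤ) (Z Zb' b₁ b₂ Z₀ Zb₀ : Form1 d (Tau 𝔸)) (L : ℕ) (μ : Fin d) (y : Fin d → ℤ) :
    symMσGAt 𝕜 ρ Z Zb' (b₁ + b₂) Z₀ Zb₀ 0 L μ y = symMσGAt 𝕜 ρ Z Zb' b₁ Z₀ Zb₀ 0 L μ y + symMσGAt 𝕜 ρ Z Zb' b₂ Z₀ Zb₀ 0 L μ y := by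
  have h := symMσGAt_add₂ (𝕜 := 𝕜) ρ Z Zb' b₁ b₂ Z₀ Zb₀ 0 0 L μ y
  rw [add_zero] at h
  exact h

/-- [folklore] The two-background σ-jet of zero backgrounds vanishes. -/
@[simp] theorem symMσGAt_zero_zero (ρ : Fin d → ℤ) (Z Zb' Z₀ Zb₀ : Form1 d (Tau 𝔸)) (L : ℕ) (μ : Fin d) (y : Fin d → ℤ) :
    symMσGAt 𝕜 ρ Z Zb' (0 : Form1 d (Tau 𝔸)) Z₀ Zb₀ 0 L μ y = 0 := by
  have h := symMσGAt_add₂ (𝕜 := 𝕜) ρ Z Zb' (0 : Form1 d (Tau 𝔸)) 0 Z₀ Zb₀ 0 0 L μ y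
  simp only [add_zero] at h
  exact left_eq_add.mp h

/-- [folklore] The σ-jet of the zero background vanishes. -/
@[simp] theorem symMσLAt_zero (ρ : Fin d → ℤ) (Z Zb' Z₀ Zb₀ : Form1 d (Tau 𝔸)) (L : ℕ) (μ : Fin d) (y : Fin d → ℤ) :
    symMσLAt 𝕜 ρ Z Zb' Z₀ Zb₀ (0 : Form1 d (Tau 𝔸)) L μ y = 0 := by
  rw [symMσLAt_eq_symMσGAt]; exact symMσGAt_zero_zero ρ Z Zb' Z₀ Zb₀ L μ y

/-- [folklore] The σ-jet is odd in the background letter. -/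
theorem symMσLAt_neg (ρ : Fin d → ℤ) (Z Zb' Z₀ Zb₀ b : Form1 d (Tau 𝔸)) (L : ℕ) (μ : Fin d) (y : Fin d → ℤ) :
    symMσLAt 𝕜 ρ Z Zb' Z₀ Zb₀ (-b) L μ y = -symMσLAt 𝕜 ρ Z Zb' Z₀ Zb₀ b L μ y := by
  have h := symMσLAt_add (𝕜 := 𝕜) ρ Z Zb' Z₀ Zb₀ b (-b) L μ y
  rw [add_neg_cancel, symMσLAt_zero] at h
  exact (neg_eq_of_add_eq_zero_right h.symm).symm

/-- [folklore] -/
theorem symMσLAt_sub (ρ : Fin d → ℤ) (Z Zb' Z₀ Zb₀ b₁ b₂ : Form1 d (Tau 𝔸)) (L : ℕ) (μ : Fin d) (y : Fin d → ℤ) :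
    symMσLAt 𝕜 ρ Z Zb' Z₀ Zb₀ (b₁ - b₂) L μ y = symMσLAt 𝕜 ρ Z Zb' Z₀ Zb₀ b₁ L μ y - symMσLAt 𝕜 ρ Z Zb' Z₀ Zb₀ b₂ L μ y := by
  rw [sub_eq_add_neg, symMσLAt_add, symMσLAt_neg, ← sub_eq_add_neg]

/-- [folklore] Finite additivity. -/
theorem symMσLAt_sum {ι' : Type*} (s : Finset ι') (b : ι' → Form1 d (Tau 𝔸)) (ρ : Fin d → ℤ) (Z Zb' Z₀ Zb₀ : Form1 d (Tau 𝔸))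
    (L : ℕ) (μ : Fin d) (y : Fin d → ℤ) :
    symMσLAt 𝕜 ρ Z Zb' Z₀ Zb₀ (∑ i ∈ s, b i) L μ y = ∑ i ∈ s, symMσLAt 𝕜 ρ Z Zb' Z₀ Zb₀ (b i) L μ y := by
  classical
  induction s using Finset.induction_on with
  | empty => simp
  | insert i s hi ih => rw [Finset.sum_insert hi, Finset.sum_insert hi, symMσLAt_add, ih]

/-- [folklore] ADDITIVITY of leaf-05's `symMjetLAt` in the background letter. -/
theorem symMjetLAt_add (ρ : Fin d → ℤ) (Z Zb' Z₀ Zb₀ b₁ b₂ : Form1 d (Tau 𝔸)) (L : ℕ) (μ : Fin d) (y : Fin d → ℤ) :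
    symMjetLAt 𝕜 ρ Z Zb' Z₀ Zb₀ (b₁ + b₂) L μ y = symMjetLAt 𝕜 ρ Z Zb' Z₀ Zb₀ b₁ L μ y + symMjetLAt 𝕜 ρ Z Zb' Z₀ Zb₀ b₂ L μ y := by
  rw [symMjetLAt_eq_c11_symMσLAt, symMjetLAt_eq_c11_symMσLAt, symMjetLAt_eq_c11_symMσLAt, symMσLAt_add, c11_add]

/-- [folklore] -/
@[simp] theorem symMjetLAt_zero (ρ : Fin d → ℤ) (Z Zb' Z₀ Zb₀ : Form1 d (Tau 𝔸)) (L : ℕ) (μ : Fin d) (y : Fin d → ℤ) :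
    symMjetLAt 𝕜 ρ Z Zb' Z₀ Zb₀ (0 : Form1 d (Tau 𝔸)) L μ y = 0 := by
  rw [symMjetLAt_eq_c11_symMσLAt, symMσLAt_zero]; rfl

/-- [folklore] -/
theorem symMjetLAt_neg (ρ : Fin d → ℤ) (Z Zb' Z₀ Zb₀ b : Form1 d (Tau 𝔸)) (L : ℕ) (μ : Fin d) (y : Fin d → ℤ) :
    symMjetLAt 𝕜 ρ Z Zb' Z₀ Zb₀ (-b) L μ y = -symMjetLAt 𝕜 ρ Z Zb' Z₀ Zb₀ b L μ y := by
  rw [symMjetLAt_eq_c11_symMσLAt, symMjetLAt_eq_c11_symMσLAt, symMσLAt_neg, c11_neg]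

/-- [folklore] -/
theorem symMjetLAt_sum {ι' : Type*} (s : Finset ι') (b : ι' → Form1 d (Tau 𝔸)) (ρ : Fin d → ℤ) (Z Zb' Z₀ Zb₀ : Form1 d (Tau 𝔸))
    (L : ℕ) (μ : Fin d) (y : Fin d → ℤ) :
    symMjetLAt 𝕜 ρ Z Zb' Z₀ Zb₀ (∑ i ∈ s, b i) L μ y = ∑ i ∈ s, symMjetLAt 𝕜 ρ Z Zb' Z₀ Zb₀ (b i) L μ y := by
  classical
  induction s using Finset.induction_on with
  | empty => simp
  | insert i s hi ih => rw [Finset.sum_insert hi, Finset.sum_insert hi, symMjetLAt_add, ih]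

/-! ## §3 Node 12b's mixed jet `symMjetAt` in the background `B` -/

/-- [folklore] **ADDITIVITY OF NODE 12b's ROOTED MIXED JET IN THE BACKGROUND.** -/
theorem symMjetAt_add_B (ρ : Fin d → ℤ) (W V B₁ B₂ : Form1 d 𝔸) (L : ℕ) (μ : Fin d) (y : Fin d → ℤ) :
    symMjetAt 𝕜 ρ W V (B₁ + B₂) L μ y = symMjetAt 𝕜 ρ W V B₁ L μ y + symMjetAt 𝕜 ρ W V B₂ L μ y := by
  rw [symMjetAt_eq_symMjetLAt, symMjetAt_eq_symMjetLAt, symMjetAt_eq_symMjetLAt, upF_add, symMjetLAt_add]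

/-- [folklore] -/
theorem symMjetAt_neg_B (ρ : Fin d → ℤ) (W V B : Form1 d 𝔸) (L : ℕ) (μ : Fin d) (y : Fin d → ℤ) :
    symMjetAt 𝕜 ρ W V (-B) L μ y = -symMjetAt 𝕜 ρ W V B L μ y := by
  rw [symMjetAt_eq_symMjetLAt, symMjetAt_eq_symMjetLAt, upF_neg, symMjetLAt_neg]

/-- [folklore] -/
theorem symMjetAt_sub_B (ρ : Fin d → ℤ) (W V B₁ B₂ : Form1 d 𝔸) (L : ℕ) (μ : Fin d) (y : Fin d → ℤ) :
    symMjetAt 𝕜 ρ W V (B₁ - B₂) L μ y = symMjetAt 𝕜 ρ W V B₁ L μ y - symMjetAt 𝕜 ρ W V B₂ L μ y := by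
  rw [sub_eq_add_neg, symMjetAt_add_B, symMjetAt_neg_B, ← sub_eq_add_neg]

/-- [folklore] Finite additivity of `symMjetAt` in the background. -/
theorem symMjetAt_sum_B {ι' : Type*} (s : Finset ι') (B : ι' → Form1 d 𝔸) (ρ : Fin d → ℤ) (W V : Form1 d 𝔸) (L : ℕ) (μ : Fin d)
    (y : Fin d → ℤ) :
    symMjetAt 𝕜 ρ W V (∑ i ∈ s, B i) L μ y = ∑ i ∈ s, symMjetAt 𝕜 ρ W V (B i) L μ y := by
  classical
  induction s using Finset.induction_on with
  | empty => simp [symMjetAt_B_zero]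
  | insert i s hi ih => rw [Finset.sum_insert hi, Finset.sum_insert hi, symMjetAt_add_B, ih]

end Summit.QuantumFields.BalabanUV.Beta.SymRootedMixedJetLinear
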